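import Mathlib.LinearAlgebra.Matrix.PosDef
import Mathlib.Analysis.Matrix.Spectrum
import Mathlib.Order.LiminfLimsup
import Mathlib.GroupTheory.SpecificGroups.Dihedral
import Literature.Probability.LatticeModels.LatticeGraph
import Literature.Probability.LatticeModels.CorrelationDecay
import Literature.MathematicalPhysics.QuantumLattice.LatticeTori
import Literature.MathematicalPhysics.QuantumLattice.FermionOperators
import Literature.MathematicalPhysics.QuantumLattice.HubbardModel
import HarnessLib

-- provenance: harness21/H21/H21/Prelude/QLatticeAQFT/PairCorrelations.lean @ 2642559 (interim HEAD d8f2665); M5 mechanical rewrite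
/-!
# Reduced density matrices, pair operators and pair-field long-range order

Trunk T-QLATTICE (prelude item Q8 `PairCorrelations`, notions `reduced_density_matrix_2p`,
`dwave_pair_operator`, `long_range_order`), family `hubbard`; outline design decision Q-D5.
Wave0 already owns `expect`, `twoParticleRDM` (Yang's `ρ₂`) and `HasODLRO`; they are REUSED.

## Contents

* `oneParticleRDM ψ (i, j) = ⟨ψ, c†ᵢ cⱼ ψ⟩` (Yang's `ρ₁`), `pairAmplitude x y ψ = ⟨c†_{x↑} c†_{x↓}
  c_{y↓} c_{y↑}⟩` (on-site `s`-wave / `η`-pair amplitude), Yang's geminal operator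
  `pairAnnihilator v = Σ_{(i,j)} v (i,j) c_j c_i` with `⟨(P_v)ᴴ P_v⟩ = v† ρ₂ v`.
* `Matrix.supRayleigh ρ = sup_{‖v‖ = 1} re ⟨v, ρ v⟩` (largest eigenvalue of a Hermitian matrix,
  `supRayleigh_eq_eigenvalues₀_zero`; dot-notation extension of Mathlib's `Matrix` namespace) and
  the reformulation `hasODLRO_iff_supRayleigh` of Wave0's variational `HasODLRO`.
* Pair form factors on `ℤ²`: `unitSteps = {±e₁, ±e₂}`, `sWave` (on-site), `extendedSWave`,
  `dWaveFormFactor` (`±e₁ ↦ 1`, `±e₂ ↦ -1`); the local singlet pair operator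
  `localPair g L x = Σ_{e ∈ {0} ∪ unitSteps} (g e/√2) (c_{x↑} c_{x+e,↓} - c_{x↓} c_{x+e,↑})` on the
  fermionic torus `(ℤ/Lℤ)²`, the pair field `pairField g L = Σ_x localPair g L x` (`Δ_g`), the
  two-point function `pairFieldCorr g ψ L x y = re ⟨ψ_L, (P_x)ᴴ P_y ψ_L⟩` and the LRO predicate
  **`HasPairFieldLRO g N ψ`** = normalisation ∧ `HasTorusLRO (pairFieldCorr g ψ)` (outline §0
  convention: G02's `HasLongRangeOrder` over `halfOpenBox 2 L`, whose normalisation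
  `|Λ_L|⁻² = L⁻⁴` is exactly that of the `hubbard.S01` text `liminf |Λ|⁻² ⟨Δ_d† Δ_d⟩ > 0`; no
  locally re-invented `liminf`). `hasPairFieldLRO_iff_liminf` unfolds it.
* The point group `D₄` (Mathlib `DihedralGroup 4`) acting on torus sites (`d4Site`), orbitals
  (`d4Orb`) and pair wavefunctions (`d4Act`), the `B₁g` (`x² - y²`) character `b1gChar` and the
  predicate `IsDWaveSymmetric v`; the "`ρ₂`-eigenvector" formulation `HasDWaveODLRO` and the Q-D5
  bridge `hasPairFieldLRO_dWave_of_hasODLRO` (explicit hypotheses; NOT an equivalence).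

## Mathlib search

Mathlib has `Matrix.PosSemidef`, `Matrix.posSemidef_conjTranspose_mul_self`,
`Matrix.IsHermitian.eigenvalues₀` (sorted decreasingly, `eigenvalues₀_antitone`),
`ContinuousLinearMap.rayleighQuotient` / `LinearMap.IsSymmetric` Rayleigh theory
(`Mathlib/Analysis/InnerProductSpace/Rayleigh.lean`, on inner-product spaces, not on `Matrix`),
`DihedralGroup n` (`r i`, `sr i`), `Filter.liminf`. It has no reduced density matrices, pair
operators, form factors or ODLRO (`rg -i "density matrix|ODLRO|dwave|d-wave"` finds nothing
relevant). `Matrix.supRayleigh` is kept in the elementary `dotProduct` language of Wave0's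
`HasODLRO` so that `hasODLRO_iff_supRayleigh` is a direct reformulation.

## Design notes

* `localPair` sums over `insert 0 unitSteps` (on-site and nearest-neighbour separations) so that
  the three standard form factors `sWave`, `extendedSWave`, `dWaveFormFactor` are all covered by
  one definition; for `g = dWaveFormFactor` the `e = 0` term vanishes.
* `x + e` is computed in `(ℤ/Lℤ)²` as `x + Torus.proj L e`; orbitals are obtained through
  `FermionTorus.ofTorusSite` (needs `NeZero L`). Consequently `pairFieldCorr g ψ 0 = 0` is a
  documented junk value at `L = 0` (irrelevant for a `liminf` along `atTop`).
* `Matrix.supRayleigh` has junk value `0` (`= sSup ∅`) on an empty index type.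
* Q-D5: pair-field LRO (`HasPairFieldLRO`, primary, used by `hubbard.S01`) and the
  `ρ₂`-eigenvalue form (`HasODLRO`/`HasDWaveODLRO`) are related by `⟨Δ†Δ⟩ = φ† ρ₂ φ ≥ λ |⟨v, φ⟩|²`
  for a `ρ₂`-eigenpair `(λ, v)`; the bridge lemma makes the needed overlap and density hypotheses
  explicit. They are not equivalent in general.

## Sources

C. N. Yang, *Concept of off-diagonal long-range order…*, Rev. Mod. Phys. 34 (1962) 694, §§3–4;
D. J. Scalapino, *The case for d_{x²-y²} pairing in the cuprate superconductors*, Phys. Rep. 250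
(1995) 329, §2; C. N. Yang, PRL 63 (1989) 2144 (η pairing).
-/

noncomputable section

namespace Literature.MathematicalPhysics.QuantumLattice

open Matrix Finset Filter Literature.Probability.LatticeModels
open scoped ComplexOrder

/-! ### One-particle reduced density matrix, pair amplitudes, geminal operators -/

section RDM

variable {ι : Type*} [LinearOrder ι] [Fintype ι]

/-- Yang's one-particle reduced density matrix `ρ₁(i, j) = ⟨ψ, c†ᵢ cⱼ ψ⟩` of a Fock vector `ψ`.
Yang, Rev. Mod. Phys. 34 (1962) 694, §3, eq. (6). [folklore] -/
def oneParticleRDM (ψ : Fock ι) : Matrix ι ι ℂ :=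
  fun i j => expect (creation i * annihilation j) ψ

/-- `ρ₁` unfolded. Yang, Rev. Mod. Phys. 34 (1962) 694, §3. [folklore] -/
theorem oneParticleRDM_apply (ψ : Fock ι) (i j : ι) :
    oneParticleRDM ψ i j = expect (creation i * annihilation j) ψ := rfl

/-- For a normalised `N`-particle state, `ρ₁` is positive semidefinite with trace `N`.
Yang, Rev. Mod. Phys. 34 (1962) 694, §3. [cite: Yang1962, §3] -/
def oneParticleRDM_posSemidef_trace : Prop :=
  ∀ (N : ℕ) (ψ : Fock ι) (hψ : IsNParticle N ψ) (hnorm : star ψ ⬝ᵥ ψ = 1),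
    (oneParticleRDM ψ).PosSemidef ∧ (oneParticleRDM ψ).trace = N

/-- Yang's geminal (pair) annihilation operator with pair wavefunction `v`:
`P_v = Σ_{(i,j)} v (i,j) c_j c_i`, so that `⟨ψ, (P_v)ᴴ P_w ψ⟩ = Σ conj(v p) ρ₂(p,q) w q`.
Yang, Rev. Mod. Phys. 34 (1962) 694, §4, eq. (22). [folklore] -/
def pairAnnihilator (v : ι × ι → ℂ) : Matrix (Finset ι) (Finset ι) ℂ :=
  ∑ p : ι × ι, v p • (annihilation p.2 * annihilation p.1)

/-- Yang's identity `⟨ψ, (P_v)ᴴ P_v ψ⟩ = v† ρ₂ v`. Yang, Rev. Mod. Phys. 34 (1962) 694, §4. [cite: Yang1962, §4] -/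
def expect_pairAnnihilator_conjTranspose_mul : Prop :=
  ∀ (v : ι × ι → ℂ) (ψ : Fock ι),
    expect ((pairAnnihilator v)ᴴ * pairAnnihilator v) ψ =
      star v ⬝ᵥ (twoParticleRDM ψ *ᵥ v)

end RDM

section PairAmplitude

variable {Λ : Type*} [LinearOrder Λ] [Fintype Λ]

/-- The on-site pair amplitude `⟨ψ, c†_{x↑} c†_{x↓} c_{y↓} c_{y↑} ψ⟩ = ρ₂((x↑, x↓), (y↑, y↓))`
(constant in `x ≠ y` for Yang's `η`-pairing states). Yang, PRL 63 (1989) 2144, eq. (8);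
Yang, Rev. Mod. Phys. 34 (1962) 694, §4. [folklore] -/
def pairAmplitude (x y : Λ) (ψ : Fock (Orb Λ)) : ℂ :=
  expect (creation (orb x 0) * creation (orb x 1) * annihilation (orb y 1) *
    annihilation (orb y 0)) ψ

/-- `pairAmplitude` is an entry of `ρ₂`. Yang, Rev. Mod. Phys. 34 (1962) 694, §4. [folklore] -/
theorem pairAmplitude_eq_twoParticleRDM (x y : Λ) (ψ : Fock (Orb Λ)) :
    pairAmplitude x y ψ = twoParticleRDM ψ (orb x 0, orb x 1) (orb y 0, orb y 1) := rfl

end PairAmplitude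

end Literature.MathematicalPhysics.QuantumLattice

/-! ### Largest Rayleigh quotient -/

namespace Matrix

open scoped ComplexOrder

variable {m : Type*} [Fintype m]

/-- (Dot-notation extension of Mathlib's `Matrix`.) The largest Rayleigh quotient
`sup {re ⟨v, ρ v⟩ | ‖v‖ = 1}` of a square complex matrix, in the `dotProduct` language of
`Literature.MathematicalPhysics.QuantumLattice.HasODLRO`; for Hermitian `ρ` this is the largest eigenvalue
(`supRayleigh_eq_eigenvalues₀_zero`). **Junk value** `0 = sSup ∅` when `m` is empty.
Yang, Rev. Mod. Phys. 34 (1962) 694, §4 (`λ_max` of `ρ₂`). [folklore] -/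
def supRayleigh (ρ : Matrix m m ℂ) : ℝ :=
  ⨆ v : {v : m → ℂ // star v ⬝ᵥ v = 1}, (star v.1 ⬝ᵥ (ρ *ᵥ v.1)).re

/-- Every unit-vector Rayleigh quotient is bounded by `supRayleigh`.
Yang, Rev. Mod. Phys. 34 (1962) 694, §4. [cite: Yang1962, §4] -/
def rayleigh_le_supRayleigh : Prop :=
  ∀ (ρ : Matrix m m ℂ) (v : m → ℂ) (hv : star v ⬝ᵥ v = 1),
    (star v ⬝ᵥ (ρ *ᵥ v)).re ≤ ρ.supRayleigh

/-- For a Hermitian matrix on a nonempty index type, `supRayleigh` is the largest eigenvalue,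
i.e. the first of Mathlib's decreasingly sorted `eigenvalues₀` (min–max principle).
Reed–Simon IV, Theorem XIII.1; Yang, Rev. Mod. Phys. 34 (1962) 694, §4. [cite: Yang1962, §4] -/
def supRayleigh_eq_eigenvalues₀_zero : Prop :=
  ∀ [DecidableEq m] {ρ : Matrix m m ℂ} (hρ : ρ.IsHermitian) (hm : 0 < Fintype.card m),
    ρ.supRayleigh = hρ.eigenvalues₀ ⟨0, hm⟩

end Matrix

namespace Literature.MathematicalPhysics.QuantumLattice

open Matrix Finset Filter Literature.Probability.LatticeModels
open scoped ComplexOrder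

/-- Wave0's variational `HasODLRO` rephrased with `Matrix.supRayleigh`: eventually
`λ_max(ρ₂^{(L)}) ≥ c · N L`. Yang, Rev. Mod. Phys. 34 (1962) 694, §4. [cite: Yang1962, §4] -/
def hasODLRO_iff_supRayleigh : Prop :=
  ∀ {κ : ℕ → Type*} [∀ L, LinearOrder (κ L)] [∀ L, Fintype (κ L)] (N : ℕ → ℕ) (ψ : ∀ L, Fock (κ L)),
    HasODLRO N ψ ↔
      (∀ L, IsNParticle (N L) (ψ L) ∧ star (ψ L) ⬝ᵥ ψ L = 1) ∧ Tendsto N atTop atTop ∧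
        ∃ c : ℝ, 0 < c ∧ ∀ᶠ L in atTop, c * N L ≤ (twoParticleRDM (ψ L)).supRayleigh

/-! ### Pair form factors on `ℤ²` -/

/-- The four unit steps `±e₁, ±e₂` of `ℤ²`. Scalapino, Phys. Rep. 250 (1995) 329, §2. [folklore] -/
def unitSteps : Finset (Site 2) :=
  {Pi.single 0 1, -Pi.single 0 1, Pi.single 1 1, -Pi.single 1 1}

/-- The on-site `s`-wave form factor `g(0) = 1`, `g(e) = 0` otherwise.
Scalapino, Phys. Rep. 250 (1995) 329, §2. [folklore] -/
def sWave (e : Site 2) : ℝ := if e = 0 then 1 else 0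

/-- The extended `s`-wave form factor: `1` on the four unit steps, `0` otherwise.
Scalapino, Phys. Rep. 250 (1995) 329, §2. [folklore] -/
def extendedSWave (e : Site 2) : ℝ := if e ∈ unitSteps then 1 else 0

/-- The `d_{x²-y²}` form factor: `±e₁ ↦ 1`, `±e₂ ↦ -1`, `0` otherwise.
Scalapino, Phys. Rep. 250 (1995) 329, §2, eq. (2.3). [folklore] -/
def dWaveFormFactor (e : Site 2) : ℝ :=
  if e = Pi.single 0 1 ∨ e = -Pi.single 0 1 then 1
  else if e = Pi.single 1 1 ∨ e = -Pi.single 1 1 then -1 else 0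

/-- The `d`-wave form factor vanishes at the origin. Scalapino, Phys. Rep. 250 (1995) 329, §2. [folklore] -/
@[simp] theorem dWaveFormFactor_zero : dWaveFormFactor 0 = 0 := by
  have h0 : (0 : Site 2) ≠ Pi.single 0 1 := fun h => by simpa using congrFun h 0
  have h0' : (0 : Site 2) ≠ -Pi.single 0 1 := fun h => by simpa using congrFun h 0
  have h1 : (0 : Site 2) ≠ Pi.single 1 1 := fun h => by simpa using congrFun h 1
  have h1' : (0 : Site 2) ≠ -Pi.single 1 1 := fun h => by simpa using congrFun h 1
  simp [dWaveFormFactor, h0, h0', h1, h1']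

/-- The `d`-wave form factor changes sign under the rotation `(a, b) ↦ (-b, a)` by `π/2`
(`B₁g` symmetry). Scalapino, Phys. Rep. 250 (1995) 329, §2. [cite: Scalapino1995, §2] -/
def dWaveFormFactor_rotate : Prop :=
  ∀ (e : Site 2),
    dWaveFormFactor ![-e 1, e 0] = -dWaveFormFactor e

/-! ### Local pair operators and the pair field on the torus `(ℤ/Lℤ)²` -/

section Torus

variable (g : Site 2 → ℝ) (L : ℕ) [NeZero L]

/-- The local singlet pair annihilation operator at the torus site `x` with form factor `g`:
`P_x = Σ_{e ∈ {0, ±e₁, ±e₂}} (g e / √2) (c_{x↑} c_{x+e,↓} - c_{x↓} c_{x+e,↑})`, the neighbour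
`x + e` being computed in `(ℤ/Lℤ)²` and orbitals taken on the fermionic torus via
`FermionTorus.ofTorusSite`. Deviation from the outline (which sums over `unitSteps` only): the
step `e = 0` is included so that `sWave` is covered; by `c_{x↓} c_{x↑} = -c_{x↑} c_{x↓}` the
`e = 0` term equals `√2 · g 0 · c_{x↑} c_{x↓}` (a factor `√2` relative to the usual on-site pair
`c_{x↑} c_{x↓}`, harmless for LRO predicates); it vanishes for `extendedSWave` and
`dWaveFormFactor`. Scalapino, Phys. Rep. 250 (1995) 329, §2, eq. (2.2)–(2.3). [folklore] -/
def localPair (x : TorusSite 2 L) :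
    Matrix (Finset (Orb (FermionTorus 2 L))) (Finset (Orb (FermionTorus 2 L))) ℂ :=
  ∑ e ∈ insert 0 unitSteps, ((g e / Real.sqrt 2 : ℝ) : ℂ) •
    (annihilation (orb (FermionTorus.ofTorusSite x) 0) *
        annihilation (orb (FermionTorus.ofTorusSite (x + Torus.proj L e)) 1) -
      annihilation (orb (FermionTorus.ofTorusSite x) 1) *
        annihilation (orb (FermionTorus.ofTorusSite (x + Torus.proj L e)) 0))

/-- The pair field `Δ_g = Σ_x P_x` on the torus of side `L`.
Scalapino, Phys. Rep. 250 (1995) 329, §2, eq. (2.2). [folklore] -/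
def pairField : Matrix (Finset (Orb (FermionTorus 2 L))) (Finset (Orb (FermionTorus 2 L))) ℂ :=
  ∑ x : TorusSite 2 L, localPair g L x

/-- `Δ_g† Δ_g` is positive semidefinite. (Elementary; Scalapino, Phys. Rep. 250 (1995) 329, §2.) [folklore] -/
theorem pairField_conjTranspose_mul_self_posSemidef :
    ((pairField g L)ᴴ * pairField g L).PosSemidef :=
  posSemidef_conjTranspose_mul_self _

/-- `⟨Δ_g† Δ_g⟩ = Σ_{x, y} ⟨(P_x)ᴴ P_y⟩`. Scalapino, Phys. Rep. 250 (1995) 329, §2. [cite: Scalapino1995, §2] -/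
def expect_pairField_conjTranspose_mul : Prop :=
  ∀ (ψ : Fock (Orb (FermionTorus 2 L))),
    expect ((pairField g L)ᴴ * pairField g L) ψ =
      ∑ x : TorusSite 2 L, ∑ y : TorusSite 2 L,
        expect ((localPair g L x)ᴴ * localPair g L y) ψ

end Torus

/-- The pair-field two-point function `G_L(x, y) = re ⟨ψ_L, (P_x)ᴴ P_y ψ_L⟩` of a family of
torus states `ψ L`, in the format consumed by `HasTorusLRO`. **Junk value** `0` at `L = 0`
(`FermionTorus.ofTorusSite` needs `L ≠ 0`). Scalapino, Phys. Rep. 250 (1995) 329, §2, eq. (2.4). [folklore] -/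
def pairFieldCorr (g : Site 2 → ℝ) (ψ : ∀ L, Fock (Orb (FermionTorus 2 L))) :
    (L : ℕ) → TorusSite 2 L → TorusSite 2 L → ℝ
  | 0, _, _ => 0
  | L + 1, x, y => (expect ((localPair g (L + 1) x)ᴴ * localPair g (L + 1) y) (ψ (L + 1))).re

/-- `pairFieldCorr` at positive side, unfolded. Scalapino, Phys. Rep. 250 (1995) 329, §2. [folklore] -/
@[simp] theorem pairFieldCorr_succ (g : Site 2 → ℝ) (ψ : ∀ L, Fock (Orb (FermionTorus 2 L)))
    (L : ℕ) (x y : TorusSite 2 (L + 1)) :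
    pairFieldCorr g ψ (L + 1) x y =
      (expect ((localPair g (L + 1) x)ᴴ * localPair g (L + 1) y) (ψ (L + 1))).re := rfl

/-- **Pair-field long-range order** (outline Q-D5, primary form) of a family of normalised
`N L`-particle torus states `ψ L` with form factor `g`:
`liminf_{L → ∞} |Λ_L|⁻² ⟨ψ_L, Δ_g† Δ_g ψ_L⟩ > 0`, `|Λ_L| = L²`, typed through the outline's §0
convention as `HasTorusLRO (pairFieldCorr g ψ)` (G02 `HasLongRangeOrder` over `halfOpenBox 2 L`,
normalisation `L⁻⁴`); see `hasPairFieldLRO_iff_liminf`. The normalisation and particle-number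
clauses prevent vacuous satisfaction by rescaling.
Scalapino, Phys. Rep. 250 (1995) 329, §2, eq. (2.4); Yang, Rev. Mod. Phys. 34 (1962) 694, §4. [folklore] -/
def HasPairFieldLRO (g : Site 2 → ℝ) (N : ℕ → ℕ) (ψ : ∀ L, Fock (Orb (FermionTorus 2 L))) :
    Prop :=
  (∀ L, IsNParticle (N L) (ψ L) ∧ star (ψ L) ⬝ᵥ ψ L = 1) ∧ HasTorusLRO (pairFieldCorr g ψ)

/-- Unfolding `HasPairFieldLRO` to the textbook form
`0 < liminf_{L → ∞} L⁻⁴ re ⟨ψ_L, Δ_g† Δ_g ψ_L⟩` (index shifted to `L + 1` as in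
`hasTorusLRO_iff`). Scalapino, Phys. Rep. 250 (1995) 329, §2, eq. (2.4). [cite: Scalapino1995, §2 eq. (2.4)] -/
def hasPairFieldLRO_iff_liminf : Prop :=
  ∀ (g : Site 2 → ℝ) (N : ℕ → ℕ) (ψ : ∀ L, Fock (Orb (FermionTorus 2 L))),
    HasPairFieldLRO g N ψ ↔
      (∀ L, IsNParticle (N L) (ψ L) ∧ star (ψ L) ⬝ᵥ ψ L = 1) ∧
        0 < liminf (fun L : ℕ =>
          (expect ((pairField g (L + 1))ᴴ * pairField g (L + 1)) (ψ (L + 1))).re /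
            ((L + 1 : ℕ) : ℝ) ^ 4) atTop

/-! ### The point group `D₄` on pair wavefunctions; `d`-wave symmetry -/

/-- The rotation by `π/2` of the square torus, `(a, b) ↦ (-b, a)`.
Scalapino, Phys. Rep. 250 (1995) 329, §2 (square-lattice point group `C₄ᵥ ≅ D₄`). [folklore] -/
def rotSite {L : ℕ} (x : TorusSite 2 L) : TorusSite 2 L := ![-x 1, x 0]

/-- The reflection `(a, b) ↦ (a, -b)` of the square torus in the `x`-axis.
Scalapino, Phys. Rep. 250 (1995) 329, §2. [folklore] -/
def reflSite {L : ℕ} (x : TorusSite 2 L) : TorusSite 2 L := ![x 0, -x 1]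

/-- The action of `D₄ = ⟨r, s⟩` (Mathlib `DihedralGroup 4`, `sr i = s r^i`) on torus sites:
`r i ↦ rot^i`, `sr i ↦ refl ∘ rot^i`. Scalapino, Phys. Rep. 250 (1995) 329, §2. [folklore] -/
def d4Site {L : ℕ} : DihedralGroup 4 → TorusSite 2 L → TorusSite 2 L
  | DihedralGroup.r i, x => rotSite^[i.val] x
  | DihedralGroup.sr i, x => reflSite (rotSite^[i.val] x)

/-- `d4Site` is a left action of `D₄` (with Mathlib's multiplication `sr i * r j = sr (i + j)`,
`r i * sr j = sr (j - i)`), because `rot ∘ refl = refl ∘ rot⁻¹` and `rot⁴ = 1`.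
Scalapino, Phys. Rep. 250 (1995) 329, §2. [cite: Scalapino1995, §2] -/
def d4Site_mul : Prop :=
  ∀ {L : ℕ} (γ₁ γ₂ : DihedralGroup 4) (x : TorusSite 2 L),
    d4Site (γ₁ * γ₂) x = d4Site γ₁ (d4Site γ₂ x)

/-- `d4Site 1 = id`. Scalapino, Phys. Rep. 250 (1995) 329, §2. [folklore] -/
@[simp] theorem d4Site_one {L : ℕ} (x : TorusSite 2 L) : d4Site 1 x = x := by
  rw [DihedralGroup.one_def]
  simp [d4Site]

/-- The induced action of `D₄` on Hubbard orbitals of the fermionic torus (sites moved, spin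
fixed). Scalapino, Phys. Rep. 250 (1995) 329, §2. [folklore] -/
def d4Orb {L : ℕ} [NeZero L] (γ : DihedralGroup 4) (o : Orb (FermionTorus 2 L)) :
    Orb (FermionTorus 2 L) :=
  orb (FermionTorus.ofTorusSite (d4Site γ (FermionTorus.toTorusSite (ofLex o).1))) (ofLex o).2

/-- The action of `D₄` on pair wavefunctions `v : κ × κ → ℂ` over the fermionic torus,
`(γ • v)(o₁, o₂) = v (γ⁻¹ o₁, γ⁻¹ o₂)`. Scalapino, Phys. Rep. 250 (1995) 329, §2. [folklore] -/
def d4Act {L : ℕ} [NeZero L] (γ : DihedralGroup 4)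
    (v : Orb (FermionTorus 2 L) × Orb (FermionTorus 2 L) → ℂ) :
    Orb (FermionTorus 2 L) × Orb (FermionTorus 2 L) → ℂ :=
  fun p => v (d4Orb γ⁻¹ p.1, d4Orb γ⁻¹ p.2)

/-- The `B₁g` (`x² - y²`) character of `D₄`: `-1` on the rotations by `±π/2` and on the diagonal
reflections `s r^{±1}`, `+1` on `1`, `r²` and the axis reflections `s`, `s r²`.
Scalapino, Phys. Rep. 250 (1995) 329, §2. [folklore] -/
def b1gChar : DihedralGroup 4 → ℂ
  | DihedralGroup.r i => (-1) ^ i.val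
  | DihedralGroup.sr i => (-1) ^ i.val

/-- `χ_{B₁g}` is a (one-dimensional) character of `D₄`: with Mathlib's table
`r i * r j = r (i + j)`, `sr i * sr j = r (j - i)` etc., parities of `ZMod 4` values add.
Scalapino, Phys. Rep. 250 (1995) 329, §2. [cite: Scalapino1995, §2] -/
def b1gChar_mul : Prop :=
  ∀ (γ₁ γ₂ : DihedralGroup 4),
    b1gChar (γ₁ * γ₂) = b1gChar γ₁ * b1gChar γ₂

/-- `χ_{B₁g}(1) = 1`. Scalapino, Phys. Rep. 250 (1995) 329, §2. [folklore] -/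
@[simp] theorem b1gChar_one : b1gChar 1 = 1 := by
  rw [DihedralGroup.one_def]
  simp [b1gChar]

/-- `d4Orb` is a left action of `D₄` (from `d4Site_mul` and
`toTorusSite ∘ ofTorusSite = id`). Scalapino, Phys. Rep. 250 (1995) 329, §2. [cite: Scalapino1995, §2] -/
def d4Orb_mul : Prop :=
  ∀ {L : ℕ} [NeZero L] (γ₁ γ₂ : DihedralGroup 4) (o : Orb (FermionTorus 2 L)),
    d4Orb (γ₁ * γ₂) o = d4Orb γ₁ (d4Orb γ₂ o)

/-- `d4Act` is a left action of `D₄` on pair wavefunctions: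
`(γ₁ γ₂) • v = γ₁ • (γ₂ • v)` (from the named fact `d4Orb_mul`, hypothesis `hOrb`).
Scalapino, Phys. Rep. 250 (1995) 329, §2. [folklore] -/
theorem d4Act_mul (hOrb : d4Orb_mul) {L : ℕ} [NeZero L] (γ₁ γ₂ : DihedralGroup 4)
    (v : Orb (FermionTorus 2 L) × Orb (FermionTorus 2 L) → ℂ) :
    d4Act (γ₁ * γ₂) v = d4Act γ₁ (d4Act γ₂ v) := by
  funext p
  unfold d4Orb_mul at hOrb
  simp [d4Act, _root_.mul_inv_rev, hOrb]

/-- A pair wavefunction on the fermionic torus is `d_{x²-y²}`-symmetric if it transforms in the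
`B₁g` representation of `D₄`: `γ • v = χ_{B₁g}(γ) v` for all `γ`.
Scalapino, Phys. Rep. 250 (1995) 329, §2. [folklore] -/
def IsDWaveSymmetric {L : ℕ} [NeZero L]
    (v : Orb (FermionTorus 2 L) × Orb (FermionTorus 2 L) → ℂ) : Prop :=
  ∀ γ : DihedralGroup 4, d4Act γ v = b1gChar γ • v

/-- The `ρ₂`-eigenvector ("Yang") form of `d`-wave ODLRO (outline Q-D5, alternative to
`HasPairFieldLRO dWaveFormFactor`): Wave0's `HasODLRO` with the large-eigenvalue pair
wavefunction required to be `B₁g`-symmetric. Sides are shifted to `L + 1` so that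
`FermionTorus.ofTorusSite` is available. Yang, Rev. Mod. Phys. 34 (1962) 694, §4;
Scalapino, Phys. Rep. 250 (1995) 329, §2. [folklore] -/
def HasDWaveODLRO (N : ℕ → ℕ) (ψ : ∀ L, Fock (Orb (FermionTorus 2 L))) : Prop :=
  (∀ L, IsNParticle (N L) (ψ L) ∧ star (ψ L) ⬝ᵥ ψ L = 1) ∧ Tendsto N atTop atTop ∧
    ∃ c : ℝ, 0 < c ∧ ∀ᶠ L in atTop, ∃ v : Orb (FermionTorus 2 (L + 1)) ×
        Orb (FermionTorus 2 (L + 1)) → ℂ,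
      star v ⬝ᵥ v = 1 ∧ IsDWaveSymmetric v ∧
        c * N (L + 1) ≤ (star v ⬝ᵥ (twoParticleRDM (ψ (L + 1)) *ᵥ v)).re

/-- `HasDWaveODLRO` implies Wave0's `HasODLRO`. Yang, Rev. Mod. Phys. 34 (1962) 694, §4. [cite: Yang1962, §4] -/
def HasDWaveODLRO.hasODLRO : Prop :=
  ∀ {N : ℕ → ℕ} {ψ : ∀ L, Fock (Orb (FermionTorus 2 L))} (h : HasDWaveODLRO N ψ),
    HasODLRO N ψ

/-! ### The pair wavefunction of the pair field and the Q-D5 bridge -/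

section Bridge

variable (g : Site 2 → ℝ) (L : ℕ) [NeZero L]

/-- The pair wavefunction `φ_g` of the pair field, i.e. the coefficients with
`Δ_g = P_{φ_g} = Σ_p φ_g p • c_{p.2} c_{p.1}` (`pairField_eq_pairAnnihilator`):
`φ_g (o₁, o₂) = ∓ g(e)/√2` summed over the steps `e ∈ {0} ∪ unitSteps` with `x₂ = x₁ + e` in
`(ℤ/Lℤ)²`, for `o₁ = (x₁, σ)`, `o₂ = (x₂, σ')` with opposite spins: sign `-` for
`(σ, σ') = (↑, ↓)` (because `c_{o₂} c_{o₁} = -c_{x₁↑} c_{x₂↓}` is minus the first term of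
`localPair`), sign `+` for `(σ, σ') = (↓, ↑)`; `0` for equal spins. (For `L ≥ 3` at most one
step `e` matches; for `L ≤ 2` coincident steps are summed, exactly as in `pairField`.)
Scalapino, Phys. Rep. 250 (1995) 329, §2, eq. (2.2)–(2.3). [folklore] -/
def pairFieldWavefunction (p : Orb (FermionTorus 2 L) × Orb (FermionTorus 2 L)) : ℂ :=
  ∑ e ∈ insert 0 unitSteps,
    if (ofLex p.2).1.toTorusSite = (ofLex p.1).1.toTorusSite + Torus.proj L e then
      (if (ofLex p.1).2 = 0 ∧ (ofLex p.2).2 = 1 then -((g e / Real.sqrt 2 : ℝ) : ℂ)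
        else if (ofLex p.1).2 = 1 ∧ (ofLex p.2).2 = 0 then ((g e / Real.sqrt 2 : ℝ) : ℂ)
        else 0)
    else 0

/-- The pair field is the geminal operator of its pair wavefunction, `Δ_g = P_{φ_g}`.
Scalapino, Phys. Rep. 250 (1995) 329, §2; Yang, Rev. Mod. Phys. 34 (1962) 694, §4. [cite: Scalapino1995, §2] -/
def pairField_eq_pairAnnihilator : Prop :=
  pairField g L = pairAnnihilator (pairFieldWavefunction g L)

/-- Hence `⟨ψ, Δ_g† Δ_g ψ⟩ = φ_g† ρ₂ φ_g` (from the named facts `pairField_eq_pairAnnihilator` and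
Yang's identity `expect_pairAnnihilator_conjTranspose_mul`, hypotheses `hP`, `hY`). Yang, Rev. Mod. Phys. 34 (1962) 694, §4, eq. (22). [folklore] -/
theorem expect_pairField_eq_dotProduct_twoParticleRDM
    (hY : expect_pairAnnihilator_conjTranspose_mul (ι := Orb (FermionTorus 2 L)))
    (hP : pairField_eq_pairAnnihilator g L) (ψ : Fock (Orb (FermionTorus 2 L))) :
    expect ((pairField g L)ᴴ * pairField g L) ψ =
      star (pairFieldWavefunction g L) ⬝ᵥ
        (twoParticleRDM ψ *ᵥ pairFieldWavefunction g L) := by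
  rw [show pairField g L = _ from hP, hY]

/-- The `d`-wave pair wavefunction `φ_d` transforms in the `B₁g` representation of `D₄`
(so `IsDWaveSymmetric` is not vacuous): `D₄` acts linearly on `(ℤ/Lℤ)²`, permutes
`{0} ∪ unitSteps`, and `dWaveFormFactor ∘ γ⁻¹ = χ_{B₁g}(γ) • dWaveFormFactor`
(`dWaveFormFactor_rotate`). Scalapino, Phys. Rep. 250 (1995) 329, §2. [cite: Scalapino1995, §2] -/
def isDWaveSymmetric_pairFieldWavefunction_dWave : Prop :=
  IsDWaveSymmetric (pairFieldWavefunction dWaveFormFactor L)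

end Bridge

/-- **Q-D5 bridge** (`ρ₂`-eigenvector ODLRO ⇒ pair-field LRO, under explicit hypotheses).
If a family of normalised `N L`-particle torus states (`hnorm`) has, eventually in `L`, a
`d`-wave symmetric unit `ρ₂`-eigenvector `v_L` with eigenvalue `λ_L ≥ c · N L` (Yang's ODLRO
eigenpair, `hv`) whose overlap with the `d`-wave pair wavefunction satisfies
`|⟨v_L, φ_d⟩|² ≥ c · L²`, and the density is bounded below, `N L ≥ δ L²` (`hN`, which with
`hnorm`, `hv` also gives `HasODLRO N ψ`), then
`⟨Δ_d† Δ_d⟩ = φ_d† ρ₂ φ_d ≥ λ_L |⟨v_L, φ_d⟩|² ≥ c² δ L⁴`, i.e.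
`HasPairFieldLRO dWaveFormFactor N ψ`. The two notions of `d`-wave order are **not equivalent in
general**: without the overlap hypothesis a large `B₁g` eigenvalue of `ρ₂` need not be seen by the
nearest-neighbour pair field, and conversely. Yang, Rev. Mod. Phys. 34 (1962) 694, §4;
Scalapino, Phys. Rep. 250 (1995) 329, §2. [cite: Scalapino1995, §2] -/
def hasPairFieldLRO_dWave_of_hasODLRO : Prop :=
  ∀ (N : ℕ → ℕ) (ψ : ∀ L, Fock (Orb (FermionTorus 2 L))) (hnorm : ∀ L, IsNParticle (N L) (ψ L) ∧ star (ψ L) ⬝ᵥ ψ L = 1) (hN : ∃ δ : ℝ, 0 < δ ∧ ∀ᶠ L : ℕ in atTop, δ * (L : ℝ) ^ 2 ≤ N L) (hv : ∃ c : ℝ, 0 < c ∧ ∀ᶠ L : ℕ in atTop, ∃ v : Orb (FermionTorus 2 (L + 1)) × Orb (FermionTorus 2 (L + 1)) → ℂ, ∃ ev : ℝ, star v ⬝ᵥ v = 1 ∧ IsDWaveSymmetric v ∧ twoParticleRDM (ψ (L + 1)) *ᵥ v = (ev : ℂ) • v ∧ c * N (L + 1) ≤ ev ∧ c * ((L + 1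 : ℕ) : ℝ) ^ 2 ≤ ‖star v ⬝ᵥ pairFieldWavefunction dWaveFormFactor (L + 1)‖ ^ 2),
    HasPairFieldLRO dWaveFormFactor N ψ

end Literature.MathematicalPhysics.QuantumLattice
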